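import Mathlib
import Summits.PneNP.PneNP.Theses.OneSlice
import Summits.PneNP.PneNP.Theorems.OneSliceSliceTargetSplit

/-!
# Route OneSlice, crux `MonotoneContinuation` (stmt-PneNP-18471), line `Sketch_ideator1_r1` (ProfileLine) — stub overlap_variance

HYPERGEOMETRIC VARIANCE OF THE OVERLAP (Chebyshev input for the uniform-size padding bridge `MC → flat-above`).
For `x` at level `i` of the edge cube of `K_n` (`N = C(n,2)` edge slots) and a uniformly random `a`-subset `ρ`
(`ρ ∈ slice n a`, `a ≤ N`), the overlap `H(ρ) = #(supp ρ ∩ supp x)` is hypergeometric with mean `a i / N`, and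
`Σ_{ρ ∈ slice a} (H - a i/N)² ≤ #slice_a · (a i / N)`.
Proof: through the support bijection `slice n a ≃ powersetCard a univ` this is a statement about `a`-subsets
`T` of a ground finset `U` (`#U = N`) and `h_T = #(T ∩ S)` (`S = supp x`, `#S = i`).  Double counting with
`Finset.card_filter_powersetCard_subset` gives the first moment `N · Σ_T h_T = C · a · i` (`C = #powersetCard a U`)
and the second factorial moment `N (N-1) · Σ_T #(T ∩ S).offDiag = C · a (a-1) · i (i-1)`; writing
`(h - μ)² = #offDiag + (1 - 2μ) h + μ²` the claim reduces to `Σ_T #offDiag ≤ C μ²`, i.e. to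
`(a-1)(i-1) N ≤ a i (N-1)`, which is `i (N-a) + N (a-1) ≥ 0` (`a ≤ 1`: the off-diagonal sum vanishes).
-/

set_option linter.dupNamespace false -- `Summit.PneNP.PneNP.…`: summit = sub-problem (D-0017)

namespace Summit.PneNP.PneNP.Theorems.MonotoneContinuation

open Literature.Computability.Complexity hiding supp mem_supp
open Finset hiding slice
open Filter hiding mem_sdiff
open Classical
open Summit.PneNP.PneNP.Theorems (binomialWeight_tail_le binomialWeight_sum_range binomialWeight_nonneg
  binomialWeight_variance card_slice)
open Summit.PneNP.PneNP.Theorems.ConstantBand.Negative (Edge thr Central slice)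
open Summit.PneNP.PneNP.Theorems.SingleThreshold.Negative (pc)
open Summit.PneNP.PneNP.Theorems.SliceACZero.Negative (supp mem_supp card_supp supp_injective supp_indicator)
open Summit.PneNP.PneNP.Theorems.SliceTargetSplit (Comp nbhd mem_nbhd transport ind l1 nbhdCard card_nbhd
  card_nbhd_of_le card_nbhd_of_ge choose_mul_nbhdCard nbhdCard_pos sum_slice_sum_nbhd sum_slice_sum_nbhd_left
  supp_subset_of_comp_of_le comp_iff_supp comp_comm ofSet supp_ofSet ofSet_supp edgeCount_ofSet ind_nonneg
  ind_le_one abs_ind_sub_ind l1_triangle l1_comm l1_nonneg transport_nonneg transport_sub)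

noncomputable section

section Subsets

variable {α : Type*} [DecidableEq α]

/-- **Containment count, one point.** Among the `a`-subsets of a finset `U`, those containing a fixed point
`e ∈ U` number `C(#U - 1, a - 1)`; in the subtraction-free form `#{T ∋ e} · #U = #(powersetCard a U) · a`
(valid for every `a`). [folklore] -/
theorem overlap_card_filter_mem_mul (U : Finset α) (a : ℕ) {e : α} (he : e ∈ U) :
    #((powersetCard a U).filter fun T => e ∈ T) * #U = #(powersetCard a U) * a := by
  rcases Nat.eq_zero_or_pos a with rfl | hapos
  · rw [mul_zero, Nat.mul_eq_zero]
    left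
    rw [card_eq_zero, filter_eq_empty_iff]
    intro T hT
    rw [powersetCard_zero, mem_singleton] at hT
    simp [hT]
  · have h := card_filter_powersetCard_subset {e} U a (singleton_subset_iff.2 he)
      (by rw [card_singleton]; exact hapos)
    rw [card_singleton] at h
    have hfilt : ((powersetCard a U).filter fun T => e ∈ T) = (powersetCard a U).filter ({e} ⊆ ·) := by
      simp only [singleton_subset_iff]
    rw [hfilt, h, card_powersetCard]
    obtain ⟨b, rfl⟩ : ∃ b, a = b + 1 := ⟨a - 1, by omega⟩
    obtain ⟨M, hM⟩ : ∃ M, #U = M + 1 := ⟨#U - 1, by have := card_pos.2 ⟨e, he⟩; omega⟩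
    rw [hM, Nat.add_sub_cancel, Nat.add_sub_cancel, mul_comm, Nat.add_one_mul_choose_eq]

/-- **Containment count, two points.** Among the `a`-subsets of a finset `U`, those containing two fixed distinct
points `e, e' ∈ U` number `C(#U - 2, a - 2)`; in the subtraction-free form
`#{T ∋ e, e'} · #U (#U - 1) = #(powersetCard a U) · a (a - 1)` (valid for every `a`). [folklore] -/
theorem overlap_card_filter_mem_mem_mul (U : Finset α) (a : ℕ) {e e' : α} (he : e ∈ U) (he' : e' ∈ U)
    (hne : e ≠ e') :
    #((powersetCard a U).filter fun T => e ∈ T ∧ e' ∈ T) * (#U * (#U - 1)) =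
      #(powersetCard a U) * (a * (a - 1)) := by
  rcases le_or_gt a 1 with ha1 | ha2
  · have h0 : a * (a - 1) = 0 := by
      rcases Nat.eq_zero_or_pos a with rfl | h
      · rfl
      · obtain rfl : a = 1 := le_antisymm ha1 h
        rfl
    rw [h0, mul_zero, Nat.mul_eq_zero]
    left
    rw [card_eq_zero, filter_eq_empty_iff]
    intro T hT hmem
    have hT2 : 2 ≤ #T := by
      rw [← card_pair hne]
      exact card_le_card (insert_subset_iff.2 ⟨hmem.1, singleton_subset_iff.2 hmem.2⟩)
    rw [(mem_powersetCard.1 hT).2] at hT2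
    omega
  · have hsub : ({e, e'} : Finset α) ⊆ U := insert_subset_iff.2 ⟨he, singleton_subset_iff.2 he'⟩
    have h := card_filter_powersetCard_subset {e, e'} U a hsub (by rw [card_pair hne]; exact ha2)
    rw [card_pair hne] at h
    have hfilt : ((powersetCard a U).filter fun T => e ∈ T ∧ e' ∈ T) =
        (powersetCard a U).filter ({e, e'} ⊆ ·) := by
      simp only [insert_subset_iff, singleton_subset_iff]
    rw [hfilt, h, card_powersetCard]
    have hU2 : 2 ≤ #U := by rw [← card_pair hne]; exact card_le_card hsub
    obtain ⟨b, rfl⟩ : ∃ b, a = b + 2 := ⟨a - 2, by omega⟩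
    obtain ⟨M, hM⟩ : ∃ M, #U = M + 2 := ⟨#U - 2, by omega⟩
    rw [hM]
    simp only [Nat.add_sub_cancel]
    have h1 := Nat.add_one_mul_choose_eq M b
    have h2 := Nat.add_one_mul_choose_eq (M + 1) (b + 1)
    calc M.choose b * ((M + 2) * (M + 2 - 1)) = (M + 1 + 1) * ((M + 1) * M.choose b) := by
          rw [show M + 2 - 1 = M + 1 by omega]; ring
      _ = (M + 2).choose (b + 2) * ((b + 2) * (b + 2 - 1)) := by
          rw [h1, show (M + 1 + 1) * ((M + 1).choose (b + 1) * (b + 1)) =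
            ((M + 1 + 1) * (M + 1).choose (b + 1)) * (b + 1) by ring, h2,
            show b + 2 - 1 = b + 1 by omega]
          ring

/-- **First moment of the overlap.** For `S ⊆ U`, double counting gives
`(Σ_{T ∈ powersetCard a U} #(T ∩ S)) · #U = #(powersetCard a U) · a · #S`. [folklore] -/
theorem overlap_sum_card_inter_mul (U S : Finset α) (hSU : S ⊆ U) (a : ℕ) :
    (∑ T ∈ powersetCard a U, #(T ∩ S)) * #U = #(powersetCard a U) * a * #S := by
  have h1 : ∀ T : Finset α, #(T ∩ S) = ∑ e ∈ S, if e ∈ T then 1 else 0 := by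
    intro T
    rw [← card_filter, filter_mem_eq_inter, inter_comm]
  simp_rw [h1]
  rw [sum_comm, sum_mul, show #(powersetCard a U) * a * #S = ∑ e ∈ S, #(powersetCard a U) * a by
    rw [sum_const, smul_eq_mul]; ring]
  refine sum_congr rfl fun e he => ?_
  rw [← card_filter]
  exact overlap_card_filter_mem_mul U a (hSU he)

/-- **Second factorial moment of the overlap.** For `S ⊆ U`, double counting ordered pairs of distinct points gives
`(Σ_{T ∈ powersetCard a U} #(T ∩ S).offDiag) · #U (#U - 1) = #(powersetCard a U) · a (a - 1) · #S.offDiag`.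
[folklore] -/
theorem overlap_sum_card_offDiag_mul (U S : Finset α) (hSU : S ⊆ U) (a : ℕ) :
    (∑ T ∈ powersetCard a U, #(T ∩ S).offDiag) * (#U * (#U - 1)) =
      #(powersetCard a U) * (a * (a - 1)) * #S.offDiag := by
  have h1 : ∀ T : Finset α, #(T ∩ S).offDiag = ∑ p ∈ S.offDiag, if p.1 ∈ T ∧ p.2 ∈ T then 1 else 0 := by
    intro T
    rw [← card_filter]
    congr 1
    ext p
    simp only [mem_offDiag, mem_inter, mem_filter]
    tauto
  simp_rw [h1]
  rw [sum_comm, sum_mul, show #(powersetCard a U) * (a * (a - 1)) * #S.offDiag =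
    ∑ p ∈ S.offDiag, #(powersetCard a U) * (a * (a - 1)) by rw [sum_const, smul_eq_mul]; ring]
  refine sum_congr rfl fun p hp => ?_
  rw [← card_filter]
  have hp' := mem_offDiag.1 hp
  exact overlap_card_filter_mem_mem_mul U a (hSU hp'.1) (hSU hp'.2.1) hp'.2.2

/-- **Hypergeometric variance bound, finset form.** For `S ⊆ U` and `a ≤ #U`, over the `a`-subsets `T` of `U`
the overlap `#(T ∩ S)` has mean `μ = a · #S / #U` and total squared deviation at most `#(powersetCard a U) · μ`:
`Σ_T (#(T ∩ S) - μ)² ≤ #(powersetCard a U) · μ` (expand `(h - μ)² = #offDiag + (1 - 2μ) h + μ²` and use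
the two moment identities; the off-diagonal sum is at most `#(powersetCard a U) · μ²`). [folklore] -/
theorem overlap_core (U S : Finset α) (hSU : S ⊆ U) {a : ℕ} (ha : a ≤ #U) :
    ∑ T ∈ powersetCard a U, ((#(T ∩ S) : ℝ) - (a : ℝ) * #S / #U) ^ 2 ≤
      #(powersetCard a U) * ((a : ℝ) * #S / #U) := by
  rcases Nat.eq_zero_or_pos a with rfl | hapos
  · simp only [Nat.cast_zero, zero_mul, zero_div, sub_zero, mul_zero]
    refine (sum_eq_zero fun T hT => ?_).le
    have hT0 : T = ∅ := card_eq_zero.1 (mem_powersetCard.1 hT).2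
    simp [hT0]
  · have hNpos : 0 < #U := lt_of_lt_of_le hapos ha
    have hNr : (0 : ℝ) < #U := by exact_mod_cast hNpos
    -- expansion of the square through `h² = #offDiag + h`
    have hexp : ∀ T ∈ powersetCard a U, ((#(T ∩ S) : ℝ) - (a : ℝ) * #S / #U) ^ 2 =
        (#(T ∩ S).offDiag : ℝ) + (1 - 2 * ((a : ℝ) * #S / #U)) * #(T ∩ S) +
          ((a : ℝ) * #S / #U) ^ 2 := by
      intro T _
      rw [offDiag_card, Nat.cast_sub (Nat.le_mul_self _), Nat.cast_mul]
      ring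
    rw [sum_congr rfl hexp, sum_add_distrib, sum_add_distrib, sum_const, ← mul_sum, nsmul_eq_mul]
    -- the first moment, cast to `ℝ`
    have hA : (∑ T ∈ powersetCard a U, (#(T ∩ S) : ℝ)) * #U = #(powersetCard a U) * a * #S := by
      exact_mod_cast overlap_sum_card_inter_mul U S hSU a
    -- the second factorial moment bound, cast to `ℝ`
    have hD : (∑ T ∈ powersetCard a U, (#(T ∩ S).offDiag : ℝ)) * (#U : ℝ) ^ 2 ≤
        #(powersetCard a U) * (a : ℝ) ^ 2 * (#S : ℝ) ^ 2 := by
      rcases le_or_gt a 1 with ha1 | ha2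
      · have h0 : ∑ T ∈ powersetCard a U, (#(T ∩ S).offDiag : ℝ) = 0 := by
          refine sum_eq_zero fun T hT => ?_
          have hle : #(T ∩ S) ≤ 1 :=
            (card_le_card inter_subset_left).trans ((mem_powersetCard.1 hT).2.le.trans ha1)
          rw [Nat.cast_eq_zero, offDiag_card]
          rcases Nat.le_one_iff_eq_zero_or_eq_one.1 hle with h | h <;> simp [h]
        rw [h0, zero_mul]
        positivity
      · have hN2 : 2 ≤ #U := le_trans ha2 ha
        have h := overlap_sum_card_offDiag_mul U S hSU a
        rw [offDiag_card] at h
        have h' : (∑ T ∈ powersetCard a U, (#(T ∩ S).offDiag : ℝ)) * ((#U : ℝ) * ((#U : ℝ) - 1)) =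
            #(powersetCard a U) * ((a : ℝ) * ((a : ℝ) - 1)) * ((#S : ℝ) * #S - #S) := by
          have hc := congrArg (Nat.cast : ℕ → ℝ) h
          simpa only [Nat.cast_mul, Nat.cast_sum, Nat.cast_sub (Nat.le_mul_self _), Nat.cast_pred hNpos,
            Nat.cast_pred hapos] using hc
        have hNa : (0 : ℝ) ≤ (#U : ℝ) - a := sub_nonneg.2 (by exact_mod_cast ha)
        have ha1 : (0 : ℝ) ≤ (a : ℝ) - 1 := sub_nonneg.2 (by exact_mod_cast hapos)
        have hpos :
            (0 : ℝ) ≤ (#(powersetCard a U) : ℝ) * a * #S * (#S * ((#U : ℝ) - a) + #U * ((a : ℝ) - 1)) :=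
          mul_nonneg (by positivity) (add_nonneg (mul_nonneg (by positivity) hNa)
            (mul_nonneg (by positivity) ha1))
        have key : (∑ T ∈ powersetCard a U, (#(T ∩ S).offDiag : ℝ)) * (#U : ℝ) ^ 2 * ((#U : ℝ) - 1) ≤
            #(powersetCard a U) * (a : ℝ) ^ 2 * (#S : ℝ) ^ 2 * ((#U : ℝ) - 1) := by
          linear_combination (#U : ℝ) * h' + hpos
        have hN1 : (0 : ℝ) < (#U : ℝ) - 1 := by
          have : (2 : ℝ) ≤ #U := by exact_mod_cast hN2
          linarith
        exact le_of_mul_le_mul_right key hN1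
    -- final algebra
    set μ : ℝ := (a : ℝ) * #S / #U
    have hμN : μ * #U = (a : ℝ) * #S := div_mul_cancel₀ _ hNr.ne'
    set A : ℝ := ∑ T ∈ powersetCard a U, (#(T ∩ S) : ℝ)
    set D : ℝ := ∑ T ∈ powersetCard a U, (#(T ∩ S).offDiag : ℝ)
    have hAμ : A = #(powersetCard a U) * μ := by
      refine mul_right_cancel₀ hNr.ne' ?_
      linear_combination hA - (#(powersetCard a U) : ℝ) * hμN
    have hDμ : D ≤ #(powersetCard a U) * μ ^ 2 := by
      refine le_of_mul_le_mul_right ?_ (by positivity : (0 : ℝ) < (#U : ℝ) ^ 2)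
      calc D * (#U : ℝ) ^ 2 ≤ #(powersetCard a U) * (a : ℝ) ^ 2 * (#S : ℝ) ^ 2 := hD
        _ = #(powersetCard a U) * μ ^ 2 * (#U : ℝ) ^ 2 := by
          linear_combination (-(#(powersetCard a U) : ℝ) * (μ * #U + a * #S)) * hμN
    rw [hAμ]
    linear_combination hDμ

end Subsets

variable {n : ℕ}

/-- Sums over the Hamming slice `a` are sums over the `a`-subsets of the edge set, through the support
bijection `ρ ↦ supp ρ`. [folklore] -/
theorem overlap_sum_slice_eq_sum_powersetCard (a : ℕ) (F : Finset (Edge n) → ℝ) :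
    ∑ ρ ∈ slice n a, F (supp ρ) = ∑ T ∈ powersetCard a (univ : Finset (Edge n)), F T := by
  refine sum_nbij' supp ofSet ?_ ?_ ?_ ?_ ?_
  · intro ρ hρ
    rw [mem_powersetCard]
    exact ⟨subset_univ _, by rw [card_supp]; exact (mem_filter.1 hρ).2⟩
  · intro T hT
    rw [mem_powersetCard] at hT
    exact mem_filter.2 ⟨mem_univ _, by rw [edgeCount_ofSet]; exact hT.2⟩
  · intro ρ _; exact ofSet_supp ρ
  · intro T _; exact supp_ofSet T
  · intro ρ _; rfl

/-- **Hypergeometric variance of the overlap.** For an edge vector `x` of `K_n` with `e(x) = i` and `a ≤ C(n,2)`,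
over the Hamming slice `a` the overlap `H(ρ) = #(supp ρ ∩ supp x)` (a hypergeometric variable: population
`C(n,2)`, `i` marked, `a` drawn, mean `a i / C(n,2)`) has total squared deviation from its mean at most
`#slice_a · a i / C(n,2)`: `Σ_{ρ ∈ slice a} (H(ρ) - a i/C(n,2))² ≤ #slice_a · (a i / C(n,2))` (its variance
`a (i/N)(1 - i/N)(N-a)/(N-1)` is at most its mean). [folklore] -/
theorem overlap_variance :
  ∀ (n i a : ℕ) (x : Edge n → Bool), edgeCount x = i → a ≤ n.choose 2 →
    ∑ ρ ∈ slice n a, ((#(supp ρ ∩ supp x) : ℝ) - (a : ℝ) * i / (n.choose 2)) ^ 2 ≤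
      #(slice n a) * ((a : ℝ) * i / (n.choose 2)) := by
  intro n i a x hx ha
  subst hx
  have hN : #(univ : Finset (Edge n)) = n.choose 2 := by rw [card_univ, card_edgeSet_top_fin]
  have hcard : #(slice n a) = #(powersetCard a (univ : Finset (Edge n))) := by
    rw [card_slice, card_powersetCard, hN]
  rw [overlap_sum_slice_eq_sum_powersetCard a
      (fun T => ((#(T ∩ supp x) : ℝ) - (a : ℝ) * edgeCount x / (n.choose 2)) ^ 2),
    hcard, ← card_supp x, ← hN]
  exact overlap_core univ (supp x) (subset_univ _) (hN ▸ ha)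

end

end Summit.PneNP.PneNP.Theorems.MonotoneContinuation
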